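/-
Copyright (c) 2026. All rights reserved.
Released under Apache 2.0 license as described in the file LICENSE.
-/
import Literature.NumberTheory.ComplexMultiplication.DegenerateCMTypesElementaryAbelianNine
import Literature.AlgebraicGeometry.Pohlmann1968.DegenerateCMTypesCyclicCMFieldPrimeSquare
import HarnessLib

/-!
# CM fields with Galois group `⟨ρ⟩ × ℤₚ²` (commutative, non-cyclic, of order `2p²`): Dodson's second minimal
# group of degree `9` at the level of CM fields and abelian varieties — exceptional `(p,p)`-classes, the Hodge
# conjecture for powers, and Remark 4.7 for all ABELIAN CM fields of degree `18`

B. Dodson, *On the Mumford–Tate group of an abelian variety with complex multiplication*, J. Algebra **111**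
(1987) 49–73 [Dodson1987] (held text `paper:doi-10-1016-0021-8693-87-90242-0`, pp. 69–71), §4.1: the ranks of
the CM types on the minimal groups `⟨ρ⟩ × R₀`, "`R₀` one of the two regular groups of degree `9`" (`ℤ₉`, `ℤ₃²`);
Prop. 4.1 (weights prime to `3` are nondegenerate), Prop. 4.4 (2) (`R₀ = ℤ₃²`: "(a) the orbits of order `9` give
types with rank(`f`) `= 8` and (b) there are twelve `f` in four `ℤ₃²`-orbits of order `3` … an orbit of types
consisting of the union of any two orbits corresponds to types with rank `6`, and such an orbit occurs for certain
`G₀` properly containing `R₀ = ℤ₃²`"), Remark 4.7 ("Let `A` be a simple Abelian variety with complex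
multiplication, and suppose that the dimension of `A` is `9`. Then Rank(`A`) `= 6, 8`, or `10`").

This is the number-field / abelian-variety dress of the group-level files `DegenerateCMTypesElementaryAbelianPrimeSquare`
(row g35-#4: `rank + (p − 1)·t = p² + 1` on `⟨ρ⟩ × (ℤ/p)²`) and `DegenerateCMTypesElementaryAbelianNine` (row g35-#5:
`p = 3`, ranks `{10, 8, 4, 2}`), parallel to `DegenerateCMTypesCyclicCMFieldPrimeSquare` (the cyclic minimal group
`⟨ρ⟩ × ℤ_{p²}`).  Throughout, `K` is a CM field, Galois over `ℚ` with COMMUTATIVE Galois group of order `2p²`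
(`p` an odd prime), `ρ ∈ Gal(K/ℚ)` the complex conjugation (`hρ`), and — in §2–§3 — `(τ, κ)` a FRAME: `τ, κ` of
order `p`, `κ ∉ ⟨τ⟩` (it exists iff the group is not cyclic, §1); the Galois-level type of a CM type `Φ` is
`{g : σ_g = φ₀ ∘ g⁻¹ ∈ Φ}` (written out, `CyclicTwoOddPrimes.mem_galType_iff`), its rank is Kubota's
(`cmTypeRank_eq_typeRank_galType`), "equidistributed over the cosets of `⟨τ⟩`" is `HasConstantRows p p · τ κ` and
"over the cosets of `⟨τʲκ⟩`" is `HasConstantRows p p · (τʲκ) τ`.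

## What is PROVED (theorems only; no definition, no named fact, no `sorry`)

* §0 (group level, any frame) HAZAMA'S WEIGHT-`p` SETS `Δ(y₁, y₂) = κ^{y₁}⟨τ⟩ ∪ ρκ^{y₂}⟨τ⟩` (the tree's
  `hazamaSet p ρ τ κ y₁ y₂`): `card_hazamaSet` (`2p`), **`isBalanced_hazamaSet`** (balanced for every type
  equidistributed over the cosets of `⟨τ⟩`), `exists_mem_hazamaSet_rho_mul_not_mem` (height one).
* §1 (group level) **`exists_frame_of_not_isCyclic`** — a commutative NON-cyclic group of order `2p²` with an
  involution has a frame (its exponent is `2p`; the `2`-torsion has `≤ 2` elements, so the `p`-torsion has `≥ p²`);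
  `isCyclic_of_orderOf_eq_sq` (an element of order `p²` makes it cyclic): `R₀ ∈ {ℤ_{p²}, ℤₚ²}`.
* §2 THE CM TYPES OF `K` in a frame: **`not_isNondegenerate_iff`** / `isNondegenerate_iff` (degenerate iff
  equidistributed over the cosets of `⟨τ⟩` or of some `⟨τʲκ⟩`), **`isPrimitive_iff_not_isStableUnder`**,
  **`cmTypeRank_add_defect_eq`** (`Rank + (p − 1)·t = p² + 1`), `cmTypeRank_eq_or_of_not_isPrimitive` (`p + 1` or
  `2`), **`isNondegenerate_of_not_dvd`** (PROP. 4.1 for `R₀ = ℤₚ²`), `p = 3`: **`cmTypeRank_eq_or_of_isPrimitive_three`**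
  (PROP. 4.4 (2): primitive ⟹ rank `10` or `8`, `10` iff nondegenerate), `cmTypeRank_mem_three` (`{10, 8, 4, 2}`).
* §3 ABELIAN VARIETIES `A` OF TYPE `(K; Φ)` (`IsCMTypeRealisation`): `isSimple_iff`,
  **`exists_exceptional_of_hasConstantRows`** / `…_diag` (primitive + equidistributed in one direction ⟹ a rational
  `(p,p)`-class on `A` OUTSIDE `Dᵖ(A) ⊗ ℂ`, by Pohlmann's criterion with the balanced set `Δ(0,1)` of the
  corresponding frame), **`hodgeConjectureFor_pow_or_exceptional`** (THE DICHOTOMY: the Hodge conjecture for all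
  powers of `A` with `B• = D•`, OR `A` simple of dimension `p²`, `Φ` degenerate, with such a class),
  `hodgeConjectureFor_pow_of_isNondegenerate_or_not_isSimple`.
* §4 COORDINATE-FREE: `exists_frame`, **`hodgeConjectureFor_pow_or_exceptional_of_not_isCyclic`**,
  **`hodgeConjectureFor_pow_or_exceptional_of_isMulCommutative`** (ALL CM fields with commutative Galois group of
  order `2p²`, cyclic or not: HC for all powers of `A`, or `A` simple degenerate with a `(p,p)`-class outside `Dᵖ`),
  **`cmTypeRank_eq_or_of_isPrimitive_of_isMulCommutative_eighteen`** = REMARK 4.7 for the simple abelian `9`-folds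
  whose CM field is Galois with ABELIAN group: rank `10` or `8` (never `6`, which "occurs for certain `G₀` properly
  containing `R₀`", Prop. 4.6), `cmTypeRank_mem_of_isMulCommutative_eighteen` (`{10, 8, 4, 2}`),
  **`hodgeConjectureFor_pow_or_exceptional_of_isMulCommutative_eighteen`** (simple `9`-folds: HC for all powers, or
  rank `8` with a `(3,3)`-class outside `D³(A) ⊗ ℂ`).

HONEST SCOPE.  The Hodge conjecture for the simple DEGENERATE `p²`-folds themselves (the rank-`8` nine-folds) is NOT
asserted anywhere: their exceptional `(p,p)`-classes are exhibited, not shown algebraic.  NOT here: existence of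
primitive degenerate types on `⟨ρ⟩ × ℤₚ²` for a given `K` (e.g. the weight-`p` transversals; the cyclic companion
has `exists_simple_exceptional_codim_prime_sq` for every odd `p`), the rank-`6` types of Prop. 4.4 (2b)/4.6
(non-abelian Galois closure), counts, explicit fields (`ℚ(√-d, ζ₇ + ζ₇⁻¹, ζ₉ + ζ₉⁻¹)`).

## References

* [Dodson1987] B. Dodson, J. Algebra 111 (1987) 49–73: §4.1 Prop. 4.1, Example 4.3, Prop. 4.4 (2); §4.2 Prop. 4.6,
  Remark 4.7 (pp. 69–71).
* [Hazama2003CyclicCM] F. Hazama, J. Math. Sci. Univ. Tokyo 10 (2003): §5 (5.1)–(5.3), Rem. 4.10.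
* [Kubota1965] T. Kubota, Trans. AMS 118 (1965), §4 Lemma 2.
* [Gordon1999HodgeAVSurvey] B. B. Gordon, *A survey of the Hodge conjecture for abelian varieties*, Thm. 6.4
  (Hazama), §9.2 (9.2.1)–(9.2.2) (Pohlmann/White), §9.3, 9.4.3.
* [Pohlmann1968] H. Pohlmann, Ann. of Math. 88 (1968), Thm. 1 and §3.
* [Shimura1998] G. Shimura, *Abelian varieties with complex multiplication and modular functions*, §8.2 Prop. 26.

## Provenance

Lane `lit-hodgefound` (Track 2, Layer A3/B), seat `lit-hodgefound-p10` generation 35, row g35-#6; neighbours cited by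
name, nothing restated: `DegenerateCMTypesElementaryAbelianPrimeSquare`, `DegenerateCMTypesElementaryAbelianNine`,
`DegenerateCMTypesCyclicCMFieldPrimeSquare` (`card_gal_eq`, `finrank_div_two_eq`, `dim_eq`, the non-primitive
Hodge statements for ANY CM field of degree `2p²`, the cyclic dichotomy), `DegenerateCMTypesCyclicCMFieldTwoOddPrimes`
(`galType` dictionary, `isPrimitive_iff`), `MumfordSimpleFourfoldOfPrimitive` (Pohlmann's criterion `exists_exceptional_iff_of_primitive`).
-/

set_option autoImplicit false

noncomputable section

open scoped BigOperators NumberField IsMulCommutative Classical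
open CategoryTheory NumberField

namespace Literature.AlgebraicGeometry.Pohlmann1968

namespace ElemPrimeSquare

open Literature.NumberTheory.ComplexMultiplication
open Literature.NumberTheory.ComplexMultiplication.CyclicCMType
open Literature.NumberTheory.ComplexMultiplication.CyclicCMType.ElemSq

/-! ## §0 Group level: the weight-`p` balanced set `Δ = κ^{y₁}⟨τ⟩ ∪ ρκ^{y₂}⟨τ⟩` of a type equidistributed over `⟨τ⟩` -/

section Balanced

variable {G : Type*} [CommGroup G] [Fintype G] [DecidableEq G] {p : ℕ} [hp : Fact p.Prime] {ρ τ κ : G}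
  {Φ : Finset G}

omit [Fintype G] [DecidableEq G] in
/-- `τ^{(n : ℤ/p).val} = τⁿ` for `τ` of order `p`. [folklore] -/
private theorem pow_val_natCast (hτ : orderOf τ = p) (n : ℕ) : τ ^ (n : ZMod p).val = τ ^ n := by
  haveI : NeZero p := ⟨hp.out.ne_zero⟩
  rw [ZMod.val_natCast, ← hτ, pow_mod_orderOf]

omit [Fintype G] [DecidableEq G] in
/-- **Translating a coset**: `τᵃκᵇ · τˣκʸ = τ^{x+a} κ^{y+b}` (exponents in `ℤ/p`). [folklore] -/
private theorem coord_mul (hτ : orderOf τ = p) (hκ : orderOf κ = p) (a b x y : ZMod p) :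
    τ ^ a.val * κ ^ b.val * (τ ^ x.val * κ ^ y.val) = τ ^ (x + a).val * κ ^ (y + b).val := by
  haveI : NeZero p := ⟨hp.out.ne_zero⟩
  rw [mul_mul_mul_comm, ← pow_add, ← pow_add, ← pow_val_natCast hτ, ← pow_val_natCast hκ, Nat.cast_add,
    Nat.cast_add, ZMod.natCast_zmod_val, ZMod.natCast_zmod_val, ZMod.natCast_zmod_val, ZMod.natCast_zmod_val,
    add_comm a x, add_comm b y]

omit [DecidableEq G] in
/-- In `⟨ρ⟩ × ⟨τ⟩ × ⟨κ⟩` no `ρτˣκʸ` is a `τˣ'κʸ'`. [folklore] -/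
private theorem rho_mul_ne (hp2 : p ≠ 2) (hτ : orderOf τ = p) (hκ : orderOf κ = p)
    (hτκ : κ ∉ Subgroup.zpowers τ) (hcard : Fintype.card G = 2 * p ^ 2) (hρ1 : ρ ≠ 1) (hρ2 : ρ * ρ = 1)
    (x y x' y' : ZMod p) : ρ * (τ ^ x.val * κ ^ y.val) ≠ τ ^ x'.val * κ ^ y'.val := fun h =>
  Sum.inr_ne_inl ((coord_bijective hp2 hτ hκ hτκ hcard hρ1 hρ2).1 (a₁ := Sum.inr (x, y))
    (a₂ := Sum.inl (x', y')) h)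

omit [Fintype G] [DecidableEq G] in
/-- `x ↦ τˣκʸ` is injective on `ℤ/p` (fixed `y`). [cite: Dodson1987, Example 4.3] -/
private theorem pow_mul_pow_injective_left (hτ : orderOf τ = p) (hκ : orderOf κ = p)
    (hτκ : κ ∉ Subgroup.zpowers τ) (y : ZMod p) :
    Function.Injective fun x : ZMod p => τ ^ x.val * κ ^ y.val := fun x x' h =>
  (Prod.ext_iff.1 (pow_mul_pow_injective hτ hκ hτκ (a₁ := (x, y)) (a₂ := (x', y)) h)).1

omit [Fintype G] [DecidableEq G] in
/-- `x ↦ ρτˣκʸ` is injective on `ℤ/p` (fixed `y`). [cite: Dodson1987, Example 4.3] -/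
private theorem rho_mul_pow_mul_pow_injective_left (hτ : orderOf τ = p) (hκ : orderOf κ = p)
    (hτκ : κ ∉ Subgroup.zpowers τ) (y : ZMod p) :
    Function.Injective fun x : ZMod p => ρ * (τ ^ x.val * κ ^ y.val) := fun _ _ h =>
  pow_mul_pow_injective_left hτ hκ hτκ y (mul_left_cancel h)

/-- The two halves of `Δ(y₁, y₂) = κ^{y₁}⟨τ⟩ ∪ ρκ^{y₂}⟨τ⟩` are disjoint. [folklore] -/
private theorem disjoint_parts (hp2 : p ≠ 2) (hτ : orderOf τ = p) (hκ : orderOf κ = p)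
    (hτκ : κ ∉ Subgroup.zpowers τ) (hcard : Fintype.card G = 2 * p ^ 2) (hρ1 : ρ ≠ 1) (hρ2 : ρ * ρ = 1)
    (y₁ y₂ : ZMod p) :
    Disjoint (Finset.univ.image fun x : ZMod p => τ ^ x.val * κ ^ y₁.val)
      (Finset.univ.image fun x : ZMod p => ρ * (τ ^ x.val * κ ^ y₂.val)) := by
  rw [Finset.disjoint_left]
  intro d hd hd'
  obtain ⟨x, -, rfl⟩ := Finset.mem_image.1 hd
  obtain ⟨x', -, he⟩ := Finset.mem_image.1 hd'
  exact rho_mul_ne hp2 hτ hκ hτκ hcard hρ1 hρ2 _ _ _ _ he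

/-- **`#Δ(y₁, y₂) = 2p`** for the tree's `hazamaSet p ρ τ κ y₁ y₂ = κ^{y₁}⟨τ⟩ ∪ ρκ^{y₂}⟨τ⟩` (weight `p`).
[cite: Hazama2003CyclicCM, §5 ("the weight … equal to `p`")] -/
theorem card_hazamaSet (hp2 : p ≠ 2) (hτ : orderOf τ = p) (hκ : orderOf κ = p)
    (hτκ : κ ∉ Subgroup.zpowers τ) (hcard : Fintype.card G = 2 * p ^ 2) (hρ1 : ρ ≠ 1) (hρ2 : ρ * ρ = 1)
    (y₁ y₂ : ZMod p) :
    haveI : NeZero p := ⟨hp.out.ne_zero⟩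
    (hazamaSet p ρ τ κ y₁ y₂).card = 2 * p := by
  unfold hazamaSet
  rw [Finset.card_union_of_disjoint (disjoint_parts hp2 hτ hκ hτκ hcard hρ1 hρ2 y₁ y₂),
    Finset.card_image_of_injective _ (pow_mul_pow_injective_left hτ hκ hτκ y₁),
    Finset.card_image_of_injective _ (rho_mul_pow_mul_pow_injective_left hτ hκ hτκ y₂), Finset.card_univ,
    ZMod.card, two_mul]

omit [Fintype G] in
/-- Shifting the index of a row count. [folklore] -/
private theorem card_filter_add_eq (a : ZMod p) (P : ZMod p → Prop) [DecidablePred P] :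
    (Finset.univ.filter fun x : ZMod p => P (x + a)).card = (Finset.univ.filter P).card := by
  refine Finset.card_bij (fun x _ => x + a) (fun x hx => ?_) (fun x _ x' _ h => add_right_cancel h)
    fun x hx => ⟨x - a, ?_, sub_add_cancel x a⟩
  · exact Finset.mem_filter.2 ⟨Finset.mem_univ _, (Finset.mem_filter.1 hx).2⟩
  · refine Finset.mem_filter.2 ⟨Finset.mem_univ _, ?_⟩
    rw [sub_add_cancel]; exact (Finset.mem_filter.1 hx).2

omit [Fintype G] in
/-- Complementary row count: `#{x : τˣκʸ ∉ S} = p − #{x : τˣκʸ ∈ S}`. [folklore] -/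
private theorem card_filter_not_mem_row (Φ : Finset G) (y : ZMod p) :
    haveI : NeZero p := ⟨hp.out.ne_zero⟩
    (Finset.univ.filter fun x : ZMod p => τ ^ x.val * κ ^ y.val ∉ Φ).card = p - rowCount p p Φ τ κ y := by
  haveI : NeZero p := ⟨hp.out.ne_zero⟩
  unfold rowCount
  have := Finset.card_filter_add_card_filter_not
    (s := (Finset.univ : Finset (ZMod p))) (fun x : ZMod p => τ ^ x.val * κ ^ y.val ∈ Φ)
  rw [Finset.card_univ, ZMod.card] at this
  omega

/-- **`Δ(y₁, y₂)` is a balanced weight for every type equidistributed over the cosets of `⟨τ⟩`** (Pohlmann's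
condition `#(gΔ ∩ S) = p` for all `g`: a translate of a coset of `⟨τ⟩` meets `S` in the common count `c`, a
translate by `ρg` in `p − c`) — Hazama's weight-`p` kernel elements of §5, on `⟨ρ⟩ × ℤₚ²`.
[cite: Hazama2003CyclicCM, §5 (5.1)–(5.3)] [cite: Gordon1999HodgeAVSurvey, §9.2 (9.2.1)] -/
theorem isBalanced_hazamaSet (hp2 : p ≠ 2) (hτ : orderOf τ = p) (hκ : orderOf κ = p)
    (hτκ : κ ∉ Subgroup.zpowers τ) (hcard : Fintype.card G = 2 * p ^ 2) (h : IsCMTypeWith ρ (Φ : Set G))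
    (hr : haveI : NeZero p := ⟨hp.out.ne_zero⟩; HasConstantRows p p Φ τ κ) (y₁ y₂ : ZMod p) :
    haveI : NeZero p := ⟨hp.out.ne_zero⟩
    IsBalanced G (Φ : Set G) (fun d => if d ∈ hazamaSet p ρ τ κ y₁ y₂ then (1 : ℚ) else 0) := by
  haveI : NeZero p := ⟨hp.out.ne_zero⟩
  have hρ2 : ρ * ρ = 1 := by
    have := h.invol (1 : G)
    simpa [smul_eq_mul] using this
  have hρ1 : ρ ≠ 1 := by
    intro hρ
    have := h.rho_smul_ne (1 : G)
    rw [hρ, smul_eq_mul, one_mul] at this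
    exact this rfl
  rw [isBalanced_indicator_iff, card_hazamaSet hp2 hτ hκ hτκ hcard hρ1 hρ2]
  intro g
  set c := rowCount p p Φ τ κ 0 with hc
  have hrow : ∀ y, rowCount p p Φ τ κ y = c := fun y => hr y 0
  have hcle : c ≤ p := rowCount_le p p Φ τ κ 0
  have hcount1 : ∀ (a b y : ZMod p),
      ((Finset.univ.image fun x : ZMod p => τ ^ x.val * κ ^ y.val).filter
        fun d => τ ^ a.val * κ ^ b.val * d ∈ Φ).card = c := by
    intro a b y
    rw [Finset.filter_image, Finset.card_image_of_injective _ (pow_mul_pow_injective_left hτ hκ hτκ y)]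
    simp_rw [coord_mul hτ hκ]
    rw [card_filter_add_eq a (fun x : ZMod p => τ ^ x.val * κ ^ (y + b).val ∈ Φ)]
    exact hrow (y + b)
  have hcount2 : ∀ (a b y : ZMod p),
      ((Finset.univ.image fun x : ZMod p => τ ^ x.val * κ ^ y.val).filter
        fun d => ρ * (τ ^ a.val * κ ^ b.val) * d ∈ Φ).card = p - c := by
    intro a b y
    rw [Finset.filter_image, Finset.card_image_of_injective _ (pow_mul_pow_injective_left hτ hκ hτκ y)]
    simp_rw [mul_assoc ρ, coord_mul hτ hκ, rho_mul_mem_iff h]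
    rw [card_filter_add_eq a (fun x : ZMod p => τ ^ x.val * κ ^ (y + b).val ∉ Φ),
      card_filter_not_mem_row Φ (y + b), hrow]
  have hcount3 : ∀ (a b y : ZMod p),
      ((Finset.univ.image fun x : ZMod p => ρ * (τ ^ x.val * κ ^ y.val)).filter
        fun d => τ ^ a.val * κ ^ b.val * d ∈ Φ).card = p - c := by
    intro a b y
    rw [Finset.filter_image, Finset.card_image_of_injective _ (rho_mul_pow_mul_pow_injective_left hτ hκ hτκ y)]
    simp_rw [mul_left_comm _ ρ, coord_mul hτ hκ, rho_mul_mem_iff h]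
    rw [card_filter_add_eq a (fun x : ZMod p => τ ^ x.val * κ ^ (y + b).val ∉ Φ),
      card_filter_not_mem_row Φ (y + b), hrow]
  have hcount4 : ∀ (a b y : ZMod p),
      ((Finset.univ.image fun x : ZMod p => ρ * (τ ^ x.val * κ ^ y.val)).filter
        fun d => ρ * (τ ^ a.val * κ ^ b.val) * d ∈ Φ).card = c := by
    intro a b y
    rw [Finset.filter_image, Finset.card_image_of_injective _ (rho_mul_pow_mul_pow_injective_left hτ hκ hτκ y)]
    have hρρ : ∀ x : ZMod p, ρ * (τ ^ a.val * κ ^ b.val) * (ρ * (τ ^ x.val * κ ^ y.val)) =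
        τ ^ (x + a).val * κ ^ (y + b).val := fun x => by
      rw [← coord_mul hτ hκ]
      calc ρ * (τ ^ a.val * κ ^ b.val) * (ρ * (τ ^ x.val * κ ^ y.val))
          = ρ * ρ * (τ ^ a.val * κ ^ b.val * (τ ^ x.val * κ ^ y.val)) := by
            simp only [mul_assoc, mul_left_comm]
        _ = τ ^ a.val * κ ^ b.val * (τ ^ x.val * κ ^ y.val) := by rw [hρ2, one_mul]
    simp_rw [hρρ]
    rw [card_filter_add_eq a (fun x : ZMod p => τ ^ x.val * κ ^ (y + b).val ∈ Φ)]
    exact hrow (y + b)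
  obtain ⟨⟨a, b⟩, rfl | rfl⟩ := exists_coord hp2 hτ hκ hτκ hcard hρ1 hρ2 g
  · unfold hazamaSet
    rw [Finset.filter_union, Finset.card_union_of_disjoint
      ((disjoint_parts hp2 hτ hκ hτκ hcard hρ1 hρ2 y₁ y₂).mono (Finset.filter_subset _ _)
        (Finset.filter_subset _ _)), hcount1, hcount3]
    omega
  · unfold hazamaSet
    rw [Finset.filter_union, Finset.card_union_of_disjoint
      ((disjoint_parts hp2 hτ hκ hτκ hcard hρ1 hρ2 y₁ y₂).mono (Finset.filter_subset _ _)
        (Finset.filter_subset _ _)), hcount2, hcount4]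
    omega

/-- **`Δ(y₁, y₂)` is not conjugation-symmetric for `y₁ ≠ y₂`** (`κ^{y₁} ∈ Δ`, `ρκ^{y₁} ∉ Δ`: height one).
[cite: Hazama2003CyclicCM, §5 ("the height of them are equal to one")] -/
theorem exists_mem_hazamaSet_rho_mul_not_mem (hp2 : p ≠ 2) (hτ : orderOf τ = p) (hκ : orderOf κ = p)
    (hτκ : κ ∉ Subgroup.zpowers τ) (hcard : Fintype.card G = 2 * p ^ 2) (hρ1 : ρ ≠ 1) (hρ2 : ρ * ρ = 1)
    {y₁ y₂ : ZMod p} (hy : y₁ ≠ y₂) :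
    haveI : NeZero p := ⟨hp.out.ne_zero⟩
    ∃ d ∈ hazamaSet p ρ τ κ y₁ y₂, ρ * d ∉ hazamaSet p ρ τ κ y₁ y₂ := by
  haveI : NeZero p := ⟨hp.out.ne_zero⟩
  refine ⟨τ ^ (0 : ZMod p).val * κ ^ y₁.val, ?_, ?_⟩
  · unfold hazamaSet
    exact Finset.mem_union_left _ (Finset.mem_image.2 ⟨0, Finset.mem_univ _, rfl⟩)
  · unfold hazamaSet
    rw [Finset.mem_union, not_or]
    constructor
    · intro hm
      obtain ⟨x, -, he⟩ := Finset.mem_image.1 hm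
      exact rho_mul_ne hp2 hτ hκ hτκ hcard hρ1 hρ2 _ _ _ _ he.symm
    · intro hm
      obtain ⟨x, -, he⟩ := Finset.mem_image.1 hm
      have he' := pow_mul_pow_injective hτ hκ hτκ (a₁ := (x, y₂)) (a₂ := (0, y₁)) (mul_left_cancel he)
      exact hy (Prod.ext_iff.1 he').2.symm

end Balanced

/-! ## §1 A commutative NON-cyclic group of order `2p²` with an involution has a frame `(τ, κ)` of `(ℤ/p)²` -/

section FrameExists

variable {G : Type*} [CommGroup G] [Fintype G] {p : ℕ} [hp : Fact p.Prime] {ρ : G}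

/-- **`⟨ρ⟩ × R₀` with `R₀` not cyclic is `⟨ρ⟩ × ℤₚ²`**: in a commutative non-cyclic group of order `2p²` (`p` an
odd prime) containing an involution `ρ`, there are `τ, κ` of order `p` with `κ ∉ ⟨τ⟩` (the exponent is `2p`, the
`2`-torsion has at most `2` elements, so the `p`-torsion has at least `p²`).  Dodson: "`R₀` one of the two regular
groups of degree `9`", `ℤ₉` or `ℤ₃²`. [cite: Dodson1987, §4.1 (Prop. 4.1) and Example 4.3] -/
theorem exists_frame_of_not_isCyclic (hp2 : p ≠ 2) (hρ1 : ρ ≠ 1) (hρ2 : ρ * ρ = 1)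
    (hcard : Fintype.card G = 2 * p ^ 2) (hnc : ¬ IsCyclic G) :
    ∃ τ κ : G, orderOf τ = p ∧ orderOf κ = p ∧ κ ∉ Subgroup.zpowers τ := by
  have hp1 : 1 < p := hp.out.one_lt
  -- an element of order `p`
  obtain ⟨τ, hτ⟩ := exists_prime_orderOf_dvd_card p (by rw [hcard]; exact ⟨2 * p, by ring⟩)
  -- the exponent is `2p`
  have hρord : orderOf ρ = 2 := by
    haveI : Fact (Nat.Prime 2) := ⟨Nat.prime_two⟩
    exact orderOf_eq_prime (by rw [sq, hρ2]) hρ1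
  have hexp : Monoid.exponent G = 2 * p := by
    have hdvd : Monoid.exponent G ∣ 2 * p ^ 2 := by rw [← hcard]; exact Group.exponent_dvd_card
    have hne : Monoid.exponent G ≠ 2 * p ^ 2 := fun he =>
      hnc (IsCyclic.of_exponent_eq_card (by rw [he, ← hcard, Nat.card_eq_fintype_card]))
    have h2 : 2 ∣ Monoid.exponent G := hρord ▸ Monoid.order_dvd_exponent ρ
    have hpe : p ∣ Monoid.exponent G := hτ ▸ Monoid.order_dvd_exponent τ
    have h2p : 2 * p ∣ Monoid.exponent G :=
      Nat.Coprime.mul_dvd_of_dvd_of_dvd ((Nat.coprime_primes Nat.prime_two hp.out).2 hp2.symm) h2 hpe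
    obtain ⟨m, hm⟩ := h2p
    obtain ⟨c, hc⟩ := hdvd
    rw [hm] at hc hne ⊢
    have hmc : p = m * c := by
      have : 2 * p * p = 2 * p * (m * c) := by rw [← mul_assoc, ← hc]; ring
      exact Nat.eq_of_mul_eq_mul_left (by omega) this
    rcases (Nat.dvd_prime hp.out).1 (Dvd.intro _ hmc.symm) with hm1 | hmp
    · rw [hm1, mul_one]
    · exfalso; apply hne; rw [hmp]; ring
  have hpow : ∀ g : G, g ^ (2 * p) = 1 := fun g => by rw [← hexp]; exact Monoid.pow_exponent_eq_one g
  -- the `2`-torsion has at most `2` elements, so the `p`-torsion has at least `p²`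
  set f₂ : G →* G := powMonoidHom 2 with hf₂
  set fp : G →* G := powMonoidHom p with hfp
  have hU : Nat.card f₂.ker ≤ 2 := by
    have hPG : IsPGroup 2 f₂.ker := fun u => ⟨1, by
      rcases u with ⟨u, hu⟩
      rw [MonoidHom.mem_ker, hf₂, powMonoidHom_apply] at hu
      ext; simpa using hu⟩
    haveI : Fact (Nat.Prime 2) := ⟨Nat.prime_two⟩
    obtain ⟨n, hn⟩ := IsPGroup.iff_card.1 hPG
    have hdvd : Nat.card f₂.ker ∣ 2 * p ^ 2 := by
      rw [← hcard, ← Nat.card_eq_fintype_card]; exact Subgroup.card_subgroup_dvd_card _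
    rw [hn] at hdvd ⊢
    have hco : Nat.Coprime (2 ^ n) (p ^ 2) :=
      Nat.Coprime.pow n 2 ((Nat.coprime_primes Nat.prime_two hp.out).2 hp2.symm)
    exact Nat.le_of_dvd two_pos (hco.dvd_of_dvd_mul_right hdvd)
  have hrange : fp.range ≤ f₂.ker := by
    rintro _ ⟨g, rfl⟩
    rw [MonoidHom.mem_ker, hf₂, hfp, powMonoidHom_apply, powMonoidHom_apply, ← pow_mul, mul_comm, hpow]
  have hT : p ^ 2 ≤ Nat.card fp.ker := by
    have h1 := Subgroup.card_mul_index fp.ker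
    rw [Subgroup.index_ker, Nat.card_eq_fintype_card (α := G), hcard] at h1
    have h2 : Nat.card fp.range ≤ 2 := (Subgroup.card_le_of_le hrange).trans hU
    have h3 : 0 < Nat.card fp.range := Nat.card_pos
    nlinarith
  -- an element of the `p`-torsion outside `⟨τ⟩`
  have hnot : ¬ fp.ker ≤ Subgroup.zpowers τ := fun hle => by
    have := Subgroup.card_le_of_le hle
    rw [Nat.card_zpowers, hτ] at this
    nlinarith
  obtain ⟨κ, hκT, hκ⟩ := Set.not_subset.1 hnot
  refine ⟨τ, κ, hτ, ?_, hκ⟩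
  have hκp : κ ^ p = 1 := by
    have := hκT; rw [SetLike.mem_coe, MonoidHom.mem_ker, hfp, powMonoidHom_apply] at this; exact this
  exact orderOf_eq_prime hκp fun h1 => hκ (by rw [h1]; exact one_mem _)

/-- **An element of order `p²` makes `⟨ρ⟩ × R₀` cyclic**: if some `σ` has order `p²` then `ρσ` generates
(orders `2` and `p²` are coprime). [cite: Dodson1987, §4.1 (the minimal group `⟨ρ⟩ × ℤ₉`)] -/
theorem isCyclic_of_orderOf_eq_sq (hp2 : p ≠ 2) (hρ1 : ρ ≠ 1) (hρ2 : ρ * ρ = 1)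
    (hcard : Fintype.card G = 2 * p ^ 2) {σ : G} (hσ : orderOf σ = p ^ 2) : IsCyclic G := by
  have hρord : orderOf ρ = 2 := by
    haveI : Fact (Nat.Prime 2) := ⟨Nat.prime_two⟩
    exact orderOf_eq_prime (by rw [sq, hρ2]) hρ1
  have hco : (orderOf ρ).Coprime (orderOf σ) := by
    rw [hρord, hσ]
    exact Nat.Coprime.pow_right 2 ((Nat.coprime_primes Nat.prime_two hp.out).2 hp2.symm)
  have hord : orderOf (ρ * σ) = 2 * p ^ 2 := by
    rw [(Commute.all ρ σ).orderOf_mul_eq_mul_orderOf_of_coprime hco, hρord, hσ]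
  exact isCyclic_of_orderOf_eq_card (ρ * σ) (by rw [hord, ← hcard, Nat.card_eq_fintype_card])

end FrameExists

/-! ## §2 The CM types of a CM field `K` with `Gal(K/ℚ) = ⟨ρ⟩ × ℤₚ²`, in a frame `(τ, κ)` -/

open Literature.AlgebraicGeometry.Motives (AbelianVariety CMType)
open Literature.AlgebraicGeometry.HodgeTheory
open Literature.AlgebraicGeometry.VanGeemen1994 (hodgeClassSpan)
open Literature.AlgebraicGeometry.ComplexMultiplication (IsCMTypeRealisation isSimple_iff_isPrimitive
  isPrimitive_ringEquiv_complex_iff exists_isCMTypeRealisation)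
open Literature.Barriers.HodgeConjecture (divisorClassesSpan)
open Literature.AlgebraicGeometry.Pohlmann1968.CyclicTwoOddPrimes (gal_comm isCMTypeWith_galType
  cmTypeRank_eq_typeRank_galType mem_galType_iff exists_cmType_of_isCMTypeWith separating_of_forall_not_isStableUnder)
open Literature.AlgebraicGeometry.Pohlmann1968.CyclicPrimeSquare (card_gal_eq finrank_div_two_eq)

section Types

variable {K : Type} [Field K] [NumberField K] [Normal ℚ K] [IsMulCommutative (K ≃ₐ[ℚ] K)]
variable {p : ℕ} [hp : Fact p.Prime] {ρ τ κ : K ≃ₐ[ℚ] K} {φ₀ : K →+* ℂ}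

/-- **DEGENERACY CRITERION** (Kubota on `⟨ρ⟩ × ℤₚ²`): a CM type `Φ` of `K` is DEGENERATE iff its Galois-level type
`{g : σ_g ∈ Φ}` is equidistributed over the cosets of one of the `p + 1` subgroups of order `p` — `⟨τ⟩` or some
`⟨τʲκ⟩`. [cite: Dodson1987, Prop. 4.4 (2)] [cite: Kubota1965, §4 Lemma 2] -/
theorem not_isNondegenerate_iff (hp2 : p ≠ 2) (hρ : ∀ x, φ₀ (ρ x) = starRingEnd ℂ (φ₀ x))
    (hτ : orderOf τ = p) (hκ : orderOf κ = p) (hτκ : κ ∉ Subgroup.zpowers τ)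
    (hK : Module.finrank ℚ K = 2 * p ^ 2) (Φ : CMType K) :
    haveI : NeZero p := ⟨hp.out.ne_zero⟩
    ¬ IsNondegenerate Φ ↔
      HasConstantRows p p (Finset.univ.filter fun g : K ≃ₐ[ℚ] K => embOf φ₀ g ∈ Φ.1) τ κ ∨
        ∃ j : ZMod p, HasConstantRows p p (Finset.univ.filter fun g : K ≃ₐ[ℚ] K => embOf φ₀ g ∈ Φ.1)
          (τ ^ j.val * κ) τ := by
  rw [_root_.Literature.AlgebraicGeometry.Pohlmann1968.isNondegenerate_iff, cmTypeRank_eq_typeRank_galType Φ φ₀,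
    finrank_div_two_eq hK]
  exact typeRank_ne_iff hp2 hτ hκ hτκ (card_gal_eq φ₀ hK) (isCMTypeWith_galType hρ Φ)

/-- **NONDEGENERACY CRITERION**: no direction of equidistribution. [cite: Dodson1987, Prop. 4.4 (2)] [cite: Kubota1965, §4 Lemma 2] -/
theorem isNondegenerate_iff (hp2 : p ≠ 2) (hρ : ∀ x, φ₀ (ρ x) = starRingEnd ℂ (φ₀ x))
    (hτ : orderOf τ = p) (hκ : orderOf κ = p) (hτκ : κ ∉ Subgroup.zpowers τ)
    (hK : Module.finrank ℚ K = 2 * p ^ 2) (Φ : CMType K) :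
    haveI : NeZero p := ⟨hp.out.ne_zero⟩
    IsNondegenerate Φ ↔
      ¬ HasConstantRows p p (Finset.univ.filter fun g : K ≃ₐ[ℚ] K => embOf φ₀ g ∈ Φ.1) τ κ ∧
        ∀ j : ZMod p, ¬ HasConstantRows p p (Finset.univ.filter fun g : K ≃ₐ[ℚ] K => embOf φ₀ g ∈ Φ.1)
          (τ ^ j.val * κ) τ := by
  rw [_root_.Literature.AlgebraicGeometry.Pohlmann1968.isNondegenerate_iff, cmTypeRank_eq_typeRank_galType Φ φ₀,
    finrank_div_two_eq hK]
  exact typeRank_eq_iff hp2 hτ hκ hτκ (card_gal_eq φ₀ hK) (isCMTypeWith_galType hρ Φ)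

/-- **PRIMITIVITY CRITERION**: `Φ` is primitive iff its Galois-level type is stable under neither `τ` nor any `τʲκ`
(Dodson: the `ℤ₃²`-orbit of `f` has order `9`). [cite: Dodson1987, Prop. 4.4 (2)] [cite: Shimura1998, §8.2 Prop. 26] -/
theorem isPrimitive_iff_not_isStableUnder (hp2 : p ≠ 2) (hρ : ∀ x, φ₀ (ρ x) = starRingEnd ℂ (φ₀ x))
    (hτ : orderOf τ = p) (hκ : orderOf κ = p) (hτκ : κ ∉ Subgroup.zpowers τ)
    (hK : Module.finrank ℚ K = 2 * p ^ 2) (Φ : CMType K) (φh : K →+* ℂ) :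
    IsPrimitive (ℂ ≃+* ℂ) Φ.1 φh ↔
      ¬ IsStableUnder (Finset.univ.filter fun g : K ≃ₐ[ℚ] K => embOf φ₀ g ∈ Φ.1) τ ∧
        ∀ j : ZMod p, ¬ IsStableUnder (Finset.univ.filter fun g : K ≃ₐ[ℚ] K => embOf φ₀ g ∈ Φ.1)
          (τ ^ j.val * κ) := by
  rw [CyclicTwoOddPrimes.isPrimitive_iff (φ₀ := φ₀) Φ φh]
  exact forall_not_isStableUnder_iff hp2 hτ hκ hτκ (card_gal_eq φ₀ hK) (isCMTypeWith_galType hρ Φ)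

/-- **Rank plus defect `= p² + 1`**: `Rank(Φ) + (p − 1)·t(Φ) = p² + 1`, `t(Φ)` the number of directions of
equidistribution. [cite: Kubota1965, §4 Lemma 2] [cite: Dodson1987, Prop. 4.4 (2)] -/
theorem cmTypeRank_add_defect_eq (hp2 : p ≠ 2) (hρ : ∀ x, φ₀ (ρ x) = starRingEnd ℂ (φ₀ x))
    (hτ : orderOf τ = p) (hκ : orderOf κ = p) (hτκ : κ ∉ Subgroup.zpowers τ)
    (hK : Module.finrank ℚ K = 2 * p ^ 2) (Φ : CMType K) :
    haveI : NeZero p := ⟨hp.out.ne_zero⟩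
    cmTypeRank Φ +
        ((if HasConstantRows p p (Finset.univ.filter fun g : K ≃ₐ[ℚ] K => embOf φ₀ g ∈ Φ.1) τ κ
            then p - 1 else 0) +
          (Finset.univ.filter fun j : ZMod p => HasConstantRows p p
              (Finset.univ.filter fun g : K ≃ₐ[ℚ] K => embOf φ₀ g ∈ Φ.1) (τ ^ j.val * κ) τ).card * (p - 1)) =
      p ^ 2 + 1 := by
  rw [cmTypeRank_eq_typeRank_galType Φ φ₀]
  exact typeRank_add_defect_eq hp2 hτ hκ hτκ (card_gal_eq φ₀ hK) (isCMTypeWith_galType hρ Φ)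

/-- **The NON-primitive types have rank `p + 1` or `2`.** [cite: Dodson1987, Prop. 4.4 (2)(b)] [cite: Kubota1965, §4 Lemma 2] -/
theorem cmTypeRank_eq_or_of_not_isPrimitive (hp2 : p ≠ 2) (hρ : ∀ x, φ₀ (ρ x) = starRingEnd ℂ (φ₀ x))
    (hτ : orderOf τ = p) (hκ : orderOf κ = p) (hτκ : κ ∉ Subgroup.zpowers τ)
    (hK : Module.finrank ℚ K = 2 * p ^ 2) (Φ : CMType K) {φh : K →+* ℂ}
    (hnp : ¬ IsPrimitive (ℂ ≃+* ℂ) Φ.1 φh) : cmTypeRank Φ = p + 1 ∨ cmTypeRank Φ = 2 := by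
  have hst : ∃ u : K ≃ₐ[ℚ] K, u ≠ 1 ∧
      IsStableUnder (Finset.univ.filter fun g : K ≃ₐ[ℚ] K => embOf φ₀ g ∈ Φ.1) u := by
    by_contra hne
    apply hnp
    rw [CyclicTwoOddPrimes.isPrimitive_iff (φ₀ := φ₀) Φ φh]
    intro u hu hsu
    exact hne ⟨u, hu, hsu⟩
  rw [cmTypeRank_eq_typeRank_galType Φ φ₀]
  exact typeRank_eq_or_of_exists_isStableUnder hp2 hτ hκ hτκ (card_gal_eq φ₀ hK) (isCMTypeWith_galType hρ Φ) hst

/-- **Prop. 4.1 for `R₀ = ℤₚ²`**: a CM type whose weight `#{(x,y) : σ_{τˣκʸ} ∈ Φ}` is prime to `p` is nondegenerate.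
[cite: Dodson1987, Prop. 4.1] -/
theorem isNondegenerate_of_not_dvd (hp2 : p ≠ 2) (hρ : ∀ x, φ₀ (ρ x) = starRingEnd ℂ (φ₀ x))
    (hτ : orderOf τ = p) (hκ : orderOf κ = p) (hτκ : κ ∉ Subgroup.zpowers τ)
    (hK : Module.finrank ℚ K = 2 * p ^ 2) (Φ : CMType K)
    (hnd : ¬ p ∣ (Finset.univ.filter fun xy : ZMod p × ZMod p => τ ^ xy.1.val * κ ^ xy.2.val ∈
      (Finset.univ.filter fun g : K ≃ₐ[ℚ] K => embOf φ₀ g ∈ Φ.1)).card) :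
    IsNondegenerate Φ := by
  rw [_root_.Literature.AlgebraicGeometry.Pohlmann1968.isNondegenerate_iff, cmTypeRank_eq_typeRank_galType Φ φ₀,
    finrank_div_two_eq hK]
  exact typeRank_eq_of_not_dvd hp2 hτ hκ hτκ (card_gal_eq φ₀ hK) (isCMTypeWith_galType hρ Φ) hnd

/-- **`p = 3` (Dodson's dimension `9`, `R₀ = ℤ₃²`): a PRIMITIVE type has rank `10` or `8`**, and every type has
rank `10, 8, 4` or `2`. [cite: Dodson1987, Prop. 4.4 (2) and Remark 4.7] -/
theorem cmTypeRank_eq_or_of_isPrimitive_three (hρ : ∀ x, φ₀ (ρ x) = starRingEnd ℂ (φ₀ x))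
    (hτ : orderOf τ = 3) (hκ : orderOf κ = 3) (hτκ : κ ∉ Subgroup.zpowers τ)
    (hK : Module.finrank ℚ K = 18) (Φ : CMType K) {φh : K →+* ℂ} (hprim : IsPrimitive (ℂ ≃+* ℂ) Φ.1 φh) :
    (cmTypeRank Φ = 10 ∨ cmTypeRank Φ = 8) ∧ (IsNondegenerate Φ ↔ cmTypeRank Φ = 10) := by
  have hK' : Module.finrank ℚ K = 2 * 3 ^ 2 := by rw [hK]; norm_num
  have hcard : Fintype.card (K ≃ₐ[ℚ] K) = 18 := by rw [card_gal_eq φ₀ hK']; norm_num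
  refine ⟨?_, ?_⟩
  · rw [cmTypeRank_eq_typeRank_galType Φ φ₀]
    exact typeRank_eq_or_of_primitive_three hτ hκ hτκ hcard (isCMTypeWith_galType hρ Φ)
      ((CyclicTwoOddPrimes.isPrimitive_iff (φ₀ := φ₀) Φ φh).1 hprim)
  · rw [_root_.Literature.AlgebraicGeometry.Pohlmann1968.isNondegenerate_iff, hK]

/-- **Remark 4.7 on `⟨ρ⟩ × ℤ₃²` at the field level**: every CM type of `K` has rank `10, 8, 4` or `2`.
[cite: Dodson1987, Prop. 4.4 (2) and Remark 4.7] -/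
theorem cmTypeRank_mem_three (hρ : ∀ x, φ₀ (ρ x) = starRingEnd ℂ (φ₀ x))
    (hτ : orderOf τ = 3) (hκ : orderOf κ = 3) (hτκ : κ ∉ Subgroup.zpowers τ)
    (hK : Module.finrank ℚ K = 18) (Φ : CMType K) : cmTypeRank Φ ∈ ({10, 8, 4, 2} : Finset ℕ) := by
  have hK' : Module.finrank ℚ K = 2 * 3 ^ 2 := by rw [hK]; norm_num
  have hcard : Fintype.card (K ≃ₐ[ℚ] K) = 18 := by rw [card_gal_eq φ₀ hK']; norm_num
  rw [cmTypeRank_eq_typeRank_galType Φ φ₀]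
  exact typeRank_mem_three hτ hκ hτκ hcard (isCMTypeWith_galType hρ Φ)

end Types

/-! ## §3 On abelian varieties of type `(K; Φ)`: an exceptional `(p,p)`-class for each direction of equidistribution -/

section AbelianVarieties

variable {K : Type} [Field K] [NumberField K] [IsCMField K] [Normal ℚ K] [IsMulCommutative (K ≃ₐ[ℚ] K)]
variable {p : ℕ} [hp : Fact p.Prime] {ρ τ κ : K ≃ₐ[ℚ] K} {φ₀ : K →+* ℂ}
variable {Φ : CMType K} {A : AbelianVariety ℂ} {ι : 𝓞 K →+* End A} {θ : K →+* Module.End ℂ (complexBetti A.X 1)}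

omit [IsCMField K] in
/-- **`A` is simple iff the Galois-level type is stable under neither `τ` nor any `τʲκ`.**
[cite: Shimura1998, §8.2 Prop. 26] [cite: Dodson1987, Prop. 4.4 (2)] -/
theorem isSimple_iff (hp2 : p ≠ 2) (hρ : ∀ x, φ₀ (ρ x) = starRingEnd ℂ (φ₀ x))
    (hτ : orderOf τ = p) (hκ : orderOf κ = p) (hτκ : κ ∉ Subgroup.zpowers τ)
    (hK : Module.finrank ℚ K = 2 * p ^ 2) (hA : IsCMTypeRealisation Φ A ι θ) :
    A.IsSimple ↔
      ¬ IsStableUnder (Finset.univ.filter fun g : K ≃ₐ[ℚ] K => embOf φ₀ g ∈ Φ.1) τ ∧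
        ∀ j : ZMod p, ¬ IsStableUnder (Finset.univ.filter fun g : K ≃ₐ[ℚ] K => embOf φ₀ g ∈ Φ.1)
          (τ ^ j.val * κ) := by
  rw [isSimple_iff_isPrimitive hA φ₀, isPrimitive_iff_not_isStableUnder hp2 hρ hτ hκ hτκ hK Φ φ₀]

/-- **AN EXCEPTIONAL HODGE CLASS OF CODIMENSION `p` ON `A` ITSELF, from equidistribution over `⟨τ⟩`.**  If `Φ` is
PRIMITIVE and its Galois-level type meets the cosets of `⟨τ⟩` in constant numbers, every abelian variety `A` of
type `(K; Φ)` — simple, of dimension `p²` — carries a rational `(p,p)`-class OUTSIDE `Dᵖ(A) ⊗ ℂ`: the weight-`p`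
set `Δ = {σ_g : g ∈ ⟨τ⟩} ∪ {σ_{ρg} : g ∈ κ⟨τ⟩}` is Galois-balanced and not conjugation-symmetric, so Pohlmann's
criterion (`exists_exceptional_iff_of_primitive`) applies.  For `p = 3`: Dodson's rank-`8` types of `⟨ρ⟩ × ℤ₃²`
carry a `(3,3)`-class on the simple `9`-fold. [cite: Dodson1987, Prop. 4.4 (2)(a)] [cite: Hazama2003CyclicCM, §5 and Rem. 4.10]
[cite: Gordon1999HodgeAVSurvey, 9.2.2] [cite: Pohlmann1968, Thm. 1 and §3] -/
theorem exists_exceptional_of_hasConstantRows (hp2 : p ≠ 2) (hρ : ∀ x, φ₀ (ρ x) = starRingEnd ℂ (φ₀ x))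
    (hτ : orderOf τ = p) (hκ : orderOf κ = p) (hτκ : κ ∉ Subgroup.zpowers τ)
    (hK : Module.finrank ℚ K = 2 * p ^ 2)
    (hprim : ∀ u : K ≃ₐ[ℚ] K, u ≠ 1 →
      ¬ IsStableUnder (Finset.univ.filter fun g : K ≃ₐ[ℚ] K => embOf φ₀ g ∈ Φ.1) u)
    (hr : haveI : NeZero p := ⟨hp.out.ne_zero⟩
      HasConstantRows p p (Finset.univ.filter fun g : K ≃ₐ[ℚ] K => embOf φ₀ g ∈ Φ.1) τ κ)
    (hA : IsCMTypeRealisation Φ A ι θ) :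
    ∃ c : complexBetti A.X (2 * p), IsRationalClass c ∧ IsOfHodgeType (p ^ 2) A.X (2 * p) p p c ∧
      c ∉ divisorClassesSpan A.X (p ^ 2) p := by
  haveI : NeZero p := ⟨hp.out.ne_zero⟩
  haveI : Fact (1 < p) := ⟨hp.out.one_lt⟩
  have hcardG := card_gal_eq φ₀ hK
  have h := isCMTypeWith_galType hρ Φ
  have hρ1 := conjGalElt_ne_one hρ
  have hρ2 := conjGalElt_mul_self hρ
  have hinj := (embOf_bijective φ₀).1
  -- the weight-`p` set `Δ(0, 1)` on the Galois group and its image in `Hom(K, ℂ)`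
  set ΔG : Finset (K ≃ₐ[ℚ] K) := hazamaSet p ρ τ κ (0 : ZMod p) 1 with hΔG
  set Δ : Finset (K →+* ℂ) := ΔG.image (embOf φ₀) with hΔ
  have hcard : Δ.card = 2 * p := by
    rw [hΔ, Finset.card_image_of_injective _ hinj, hΔG, card_hazamaSet hp2 hτ hκ hτκ hcardG hρ1 hρ2]
  have hbalG := (isBalanced_indicator_iff (Finset.univ.filter fun g : K ≃ₐ[ℚ] K => embOf φ₀ g ∈ Φ.1) ΔG).1
    (isBalanced_hazamaSet hp2 hτ hκ hτκ hcardG h hr 0 1)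
  have hbal : IsGaloisBalanced Φ Δ := by
    rw [isGaloisBalanced_iff_two_mul]
    intro γ
    obtain ⟨δ, hδ⟩ := exists_algEquiv_comp_eq_smul φ₀ γ
    have hset : {s : K →+* ℂ | s ∈ Δ ∧ (γ : ℂ →+* ℂ).comp s ∈ Φ.1} =
        ↑((ΔG.filter fun d => δ⁻¹ * d ∈
          (Finset.univ.filter fun g : K ≃ₐ[ℚ] K => embOf φ₀ g ∈ Φ.1)).image (embOf φ₀)) := by
      ext s
      simp only [Set.mem_setOf_eq, Finset.coe_image, Finset.coe_filter, Set.mem_image, hΔ, Finset.mem_image]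
      constructor
      · rintro ⟨⟨d, hd, rfl⟩, hs⟩
        refine ⟨d, ⟨hd, ?_⟩, rfl⟩
        rw [mem_galType_iff, mul_comm, ← smul_embOf_of_comp φ₀ hδ, ringEquiv_smul_def]
        exact hs
      · rintro ⟨d, ⟨hd, hd'⟩, rfl⟩
        refine ⟨⟨d, hd, rfl⟩, ?_⟩
        rw [mem_galType_iff, mul_comm, ← smul_embOf_of_comp φ₀ hδ, ringEquiv_smul_def] at hd'
        exact hd'
    rw [hset, Set.ncard_coe_finset, Finset.card_image_of_injective _ hinj, hcard,
      ← card_hazamaSet hp2 hτ hκ hτκ hcardG hρ1 hρ2 0 1]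
    exact hbalG δ⁻¹
  have hns : ∃ φ ∈ Δ, ComplexEmbedding.conjugate φ ∉ Δ := by
    obtain ⟨d, hd, hnd⟩ := exists_mem_hazamaSet_rho_mul_not_mem hp2 hτ hκ hτκ hcardG hρ1 hρ2
      (show (0 : ZMod p) ≠ 1 from zero_ne_one)
    refine ⟨embOf φ₀ d, Finset.mem_image_of_mem _ hd, fun hc => hnd ?_⟩
    rw [conjugate_embOf gal_comm hρ, hΔ, Finset.mem_image] at hc
    obtain ⟨d', hd', he⟩ := hc
    rw [← hinj he]
    exact hd'
  have key := (exists_exceptional_iff_of_primitive hA (separating_of_forall_not_isStableUnder Φ hprim) p).2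
    ⟨Δ, ⟨hcard, hbal⟩, hns⟩
  rwa [finrank_div_two_eq hK] at key

/-- **… and from equidistribution over a diagonal subgroup `⟨τʲκ⟩`** (the frame `(τʲκ, τ)`).
[cite: Dodson1987, Prop. 4.4 (2)(a)] [cite: Hazama2003CyclicCM, §5 and Rem. 4.10] [cite: Gordon1999HodgeAVSurvey, 9.2.2] -/
theorem exists_exceptional_of_hasConstantRows_diag (hp2 : p ≠ 2) (hρ : ∀ x, φ₀ (ρ x) = starRingEnd ℂ (φ₀ x))
    (hτ : orderOf τ = p) (hκ : orderOf κ = p) (hτκ : κ ∉ Subgroup.zpowers τ)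
    (hK : Module.finrank ℚ K = 2 * p ^ 2)
    (hprim : ∀ u : K ≃ₐ[ℚ] K, u ≠ 1 →
      ¬ IsStableUnder (Finset.univ.filter fun g : K ≃ₐ[ℚ] K => embOf φ₀ g ∈ Φ.1) u)
    (j : ZMod p) (hr : haveI : NeZero p := ⟨hp.out.ne_zero⟩
      HasConstantRows p p (Finset.univ.filter fun g : K ≃ₐ[ℚ] K => embOf φ₀ g ∈ Φ.1) (τ ^ j.val * κ) τ)
    (hA : IsCMTypeRealisation Φ A ι θ) :
    ∃ c : complexBetti A.X (2 * p), IsRationalClass c ∧ IsOfHodgeType (p ^ 2) A.X (2 * p) p p c ∧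
      c ∉ divisorClassesSpan A.X (p ^ 2) p :=
  exists_exceptional_of_hasConstantRows hp2 hρ (frame_change hτ hκ hτκ j.val).1 hτ (frame_change hτ hκ hτκ j.val).2
    hK hprim hr hA

/-- **THE DICHOTOMY for a CM field with Galois group `⟨ρ⟩ × ℤₚ²`.**  For every CM type `Φ` and every abelian variety
`A` of type `(K; Φ)`: EITHER `B•(Aⁿ) ⊗ ℂ = D•(Aⁿ) ⊗ ℂ` for all `n` and the Hodge conjecture holds for every power of
`A` (the nondegenerate types and all non-primitive ones), OR `A` is simple of dimension `p²`, `Φ` is degenerate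
(equidistributed over the cosets of some `ℤₚ ⊂ ℤₚ²`) and `A` carries a rational `(p,p)`-class outside
`Dᵖ(A) ⊗ ℂ`. [cite: Dodson1987, Prop. 4.4 (2)] [cite: Gordon1999HodgeAVSurvey, Thm. 6.4, §9.3 and 9.2.2]
[cite: Hazama2003CyclicCM, Rem. 4.10] -/
theorem hodgeConjectureFor_pow_or_exceptional (hp2 : p ≠ 2) (hρ : ∀ x, φ₀ (ρ x) = starRingEnd ℂ (φ₀ x))
    (hτ : orderOf τ = p) (hκ : orderOf κ = p) (hτκ : κ ∉ Subgroup.zpowers τ)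
    (hK : Module.finrank ℚ K = 2 * p ^ 2) (Φ : CMType K) (hA : IsCMTypeRealisation Φ A ι θ) :
    ((∀ n m : ℕ, hodgeClassSpan (⨁ fun _ : Fin n => A).dim (⨁ fun _ : Fin n => A).X m =
        divisorClassesSpan (⨁ fun _ : Fin n => A).X (⨁ fun _ : Fin n => A).dim m) ∧
      ∀ n : ℕ, HodgeConjectureFor (⨁ fun _ : Fin n => A).dim (⨁ fun _ : Fin n => A).X) ∨
    (A.IsSimple ∧ A.dim = p ^ 2 ∧ ¬ IsNondegenerate Φ ∧
      ∃ c : complexBetti A.X (2 * p), IsRationalClass c ∧ IsOfHodgeType (p ^ 2) A.X (2 * p) p p c ∧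
        c ∉ divisorClassesSpan A.X (p ^ 2) p) := by
  haveI : NeZero p := ⟨hp.out.ne_zero⟩
  by_cases hΦ : IsPrimitive (ℂ ≃+* ℂ) Φ.1 φ₀
  · have hprim := (CyclicTwoOddPrimes.isPrimitive_iff (φ₀ := φ₀) Φ φ₀).1 hΦ
    by_cases hnd : IsNondegenerate Φ
    · exact Or.inl ⟨fun n m => hnd.hodgeClassSpan_pow_eq_divisorClassesSpan hA n m,
        fun n => hnd.hodgeConjectureFor_pow hA n⟩
    · refine Or.inr ⟨(isSimple_iff_isPrimitive hA φ₀).2 hΦ, CyclicPrimeSquare.dim_eq hK hA, hnd, ?_⟩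
      rcases (not_isNondegenerate_iff hp2 hρ hτ hκ hτκ hK Φ).1 hnd with hr | ⟨j, hr⟩
      · exact exists_exceptional_of_hasConstantRows hp2 hρ hτ hκ hτκ hK hprim hr hA
      · exact exists_exceptional_of_hasConstantRows_diag hp2 hρ hτ hκ hτκ hK hprim j hr hA
  · exact Or.inl ⟨fun n m => CyclicPrimeSquare.hodgeClassSpan_pow_eq_divisorClassesSpan_of_not_isPrimitive hp.out
        hK Φ φ₀ hΦ hA n m,
      fun n => CyclicPrimeSquare.hodgeConjectureFor_pow_of_not_isPrimitive hp.out hK Φ φ₀ hΦ hA n⟩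

/-- **The Hodge conjecture for all powers of `A`, whenever `Φ` is nondegenerate or `A` is not simple.**
[cite: Gordon1999HodgeAVSurvey, Thm. 6.4 and §9.3] [cite: Dodson1987, Prop. 4.4 (2)] -/
theorem hodgeConjectureFor_pow_of_isNondegenerate_or_not_isSimple (hp2 : p ≠ 2)
    (hρ : ∀ x, φ₀ (ρ x) = starRingEnd ℂ (φ₀ x)) (hτ : orderOf τ = p) (hκ : orderOf κ = p)
    (hτκ : κ ∉ Subgroup.zpowers τ) (hK : Module.finrank ℚ K = 2 * p ^ 2) (Φ : CMType K)
    (hA : IsCMTypeRealisation Φ A ι θ) (hor : IsNondegenerate Φ ∨ ¬ A.IsSimple) (n : ℕ) :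
    HodgeConjectureFor (⨁ fun _ : Fin n => A).dim (⨁ fun _ : Fin n => A).X := by
  rcases hodgeConjectureFor_pow_or_exceptional hp2 hρ hτ hκ hτκ hK Φ hA with ⟨-, h⟩ | ⟨hS, -, hnd, -⟩
  · exact h n
  · exact absurd hor (not_or.2 ⟨hnd, not_not.2 hS⟩)

end AbelianVarieties

/-! ## §4 Coordinate-free: CM fields with commutative NON-cyclic Galois group of order `2p²`, and all abelian ones -/

section CoordinateFree

open Literature.AlgebraicGeometry.ComplexMultiplication.CyclicTwoPower (exists_conj_gal)

variable {K : Type} [Field K] [NumberField K] [IsCMField K] [Normal ℚ K] {p : ℕ}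
variable {Φ : CMType K} {A : AbelianVariety ℂ} {ι : 𝓞 K →+* End A} {θ : K →+* Module.End ℂ (complexBetti A.X 1)}

/-- **A frame of `Gal(K/ℚ)`** for a CM field with commutative non-cyclic Galois group of order `2p²`: `τ, κ` of order
`p` with `κ ∉ ⟨τ⟩`, next to the complex conjugation `ρ`. [cite: Dodson1987, §4.1 and Example 4.3] -/
theorem exists_frame [IsMulCommutative (K ≃ₐ[ℚ] K)] (hp : p.Prime) (hp2 : p ≠ 2)
    (hnc : ¬ IsCyclic (K ≃ₐ[ℚ] K)) (hK : Module.finrank ℚ K = 2 * p ^ 2) {ρ : K ≃ₐ[ℚ] K} {φ₀ : K →+* ℂ}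
    (hρ : ∀ x, φ₀ (ρ x) = starRingEnd ℂ (φ₀ x)) :
    ∃ τ κ : K ≃ₐ[ℚ] K, orderOf τ = p ∧ orderOf κ = p ∧ κ ∉ Subgroup.zpowers τ := by
  haveI : Fact p.Prime := ⟨hp⟩
  exact exists_frame_of_not_isCyclic hp2 (conjGalElt_ne_one hρ) (conjGalElt_mul_self hρ) (card_gal_eq φ₀ hK) hnc

/-- **THE DICHOTOMY, commutative non-cyclic Galois group of order `2p²`, coordinate-free**: for every CM type `Φ`
of `K` and every abelian variety `A` of type `(K; Φ)`, EITHER the Hodge conjecture holds for every power of `A`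
(with `B•(Aⁿ) ⊗ ℂ = D•(Aⁿ) ⊗ ℂ`), OR `A` is SIMPLE of dimension `p²`, `Φ` is degenerate and `A` carries a rational
`(p,p)`-class outside `Dᵖ(A) ⊗ ℂ`. [cite: Dodson1987, Prop. 4.4 (2)] [cite: Gordon1999HodgeAVSurvey, Thm. 6.4, §9.3 and 9.2.2]
[cite: Hazama2003CyclicCM, Rem. 4.10] -/
theorem hodgeConjectureFor_pow_or_exceptional_of_not_isCyclic [IsMulCommutative (K ≃ₐ[ℚ] K)] (hp : p.Prime)
    (hp2 : p ≠ 2) (hnc : ¬ IsCyclic (K ≃ₐ[ℚ] K)) (hK : Module.finrank ℚ K = 2 * p ^ 2) (Φ : CMType K)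
    (hA : IsCMTypeRealisation Φ A ι θ) :
    ((∀ n m : ℕ, hodgeClassSpan (⨁ fun _ : Fin n => A).dim (⨁ fun _ : Fin n => A).X m =
        divisorClassesSpan (⨁ fun _ : Fin n => A).X (⨁ fun _ : Fin n => A).dim m) ∧
      ∀ n : ℕ, HodgeConjectureFor (⨁ fun _ : Fin n => A).dim (⨁ fun _ : Fin n => A).X) ∨
    (A.IsSimple ∧ A.dim = p ^ 2 ∧ ¬ IsNondegenerate Φ ∧
      ∃ c : complexBetti A.X (2 * p), IsRationalClass c ∧ IsOfHodgeType (p ^ 2) A.X (2 * p) p p c ∧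
        c ∉ divisorClassesSpan A.X (p ^ 2) p) := by
  haveI : Fact p.Prime := ⟨hp⟩
  obtain ⟨φ₀⟩ : Nonempty (K →+* ℂ) := inferInstance
  obtain ⟨ρ, hρ⟩ := exists_conj_gal (K := K)
  obtain ⟨τ, κ, hτ, hκ, hτκ⟩ := exists_frame hp hp2 hnc hK (hρ φ₀)
  exact hodgeConjectureFor_pow_or_exceptional hp2 (hρ φ₀) hτ hκ hτκ hK Φ hA

/-- **ALL CM fields with COMMUTATIVE Galois group of order `2p²`** (cyclic: `⟨ρ⟩ × ℤ_{p²}`, the companion file; or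
not: `⟨ρ⟩ × ℤₚ²`, this file): for every CM type and every abelian variety `A` of that type, EITHER the Hodge
conjecture holds for all powers of `A`, OR `A` is simple of dimension `p²` with a rational `(p,p)`-class outside
`Dᵖ(A) ⊗ ℂ`. [cite: Dodson1987, Prop. 4.4 and Remark 4.7] [cite: Gordon1999HodgeAVSurvey, Thm. 6.4, §9.3 and 9.2.2] -/
theorem hodgeConjectureFor_pow_or_exceptional_of_isMulCommutative [IsMulCommutative (K ≃ₐ[ℚ] K)]
    (hp : p.Prime) (hp2 : p ≠ 2) (hK : Module.finrank ℚ K = 2 * p ^ 2) (Φ : CMType K)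
    (hA : IsCMTypeRealisation Φ A ι θ) :
    (∀ n : ℕ, HodgeConjectureFor (⨁ fun _ : Fin n => A).dim (⨁ fun _ : Fin n => A).X) ∨
    (A.IsSimple ∧ A.dim = p ^ 2 ∧ ¬ IsNondegenerate Φ ∧
      ∃ c : complexBetti A.X (2 * p), IsRationalClass c ∧ IsOfHodgeType (p ^ 2) A.X (2 * p) p p c ∧
        c ∉ divisorClassesSpan A.X (p ^ 2) p) := by
  by_cases hcyc : IsCyclic (K ≃ₐ[ℚ] K)
  · rcases CyclicPrimeSquare.hodgeConjectureFor_pow_or_exceptional_of_isCyclic hcyc hp hp2 hK Φ hA with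
      ⟨-, h⟩ | ⟨hS, hd, hr, hc⟩
    · exact Or.inl h
    · refine Or.inr ⟨hS, hd, fun hN => ?_, hc⟩
      rw [_root_.Literature.AlgebraicGeometry.Pohlmann1968.isNondegenerate_iff, finrank_div_two_eq hK, hr] at hN
      have hlt : (p - 1) * p + 2 < p ^ 2 + 1 := by
        obtain ⟨k, rfl⟩ := Nat.exists_eq_add_of_le hp.one_lt.le
        rw [Nat.add_sub_cancel_left]
        have hk : 1 ≤ k := by have := hp.two_le; omega
        nlinarith
      exact hlt.ne hN
  · rcases hodgeConjectureFor_pow_or_exceptional_of_not_isCyclic hp hp2 hcyc hK Φ hA with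
      ⟨-, h⟩ | ⟨hS, hd, hnd, hc⟩
    · exact Or.inl h
    · exact Or.inr ⟨hS, hd, hnd, hc⟩

/-- **REMARK 4.7 for the simple abelian `9`-folds whose CM field is Galois over `ℚ` with ABELIAN group**: the rank
is `10` or `8` — never `6` (Dodson: `6` "occurs for certain `G₀` properly containing `R₀ = ℤ₃²`", i.e. requires a
non-abelian Galois closure, Prop. 4.6); rank `10` iff nondegenerate. [cite: Dodson1987, Prop. 4.4, Prop. 4.6 and Remark 4.7] -/
theorem cmTypeRank_eq_or_of_isPrimitive_of_isMulCommutative_eighteen [IsMulCommutative (K ≃ₐ[ℚ] K)]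
    (hK : Module.finrank ℚ K = 18) (Φ : CMType K) {φh : K →+* ℂ} (hprim : IsPrimitive (ℂ ≃+* ℂ) Φ.1 φh) :
    (cmTypeRank Φ = 10 ∨ cmTypeRank Φ = 8) ∧ (IsNondegenerate Φ ↔ cmTypeRank Φ = 10) := by
  have hK' : Module.finrank ℚ K = 2 * 3 ^ 2 := by rw [hK]; norm_num
  by_cases hcyc : IsCyclic (K ≃ₐ[ℚ] K)
  · have := CyclicPrimeSquare.cmTypeRank_eq_or_of_isPrimitive_of_isCyclic hcyc Nat.prime_three (by norm_num)
      hK' Φ hprim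
    norm_num at this
    exact this
  · obtain ⟨φ₀⟩ : Nonempty (K →+* ℂ) := inferInstance
    obtain ⟨ρ, hρ⟩ := exists_conj_gal (K := K)
    obtain ⟨τ, κ, hτ, hκ, hτκ⟩ := exists_frame Nat.prime_three (by norm_num) hcyc hK' (hρ φ₀)
    exact cmTypeRank_eq_or_of_isPrimitive_three (hρ φ₀) hτ hκ hτκ hK Φ hprim

/-- **Every CM type of a CM field of degree `18`, Galois over `ℚ` with abelian group, has rank `10, 8, 4` or `2`.**
[cite: Dodson1987, Prop. 4.4 and Remark 4.7] -/
theorem cmTypeRank_mem_of_isMulCommutative_eighteen [IsMulCommutative (K ≃ₐ[ℚ] K)]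
    (hK : Module.finrank ℚ K = 18) (Φ : CMType K) : cmTypeRank Φ ∈ ({10, 8, 4, 2} : Finset ℕ) := by
  have hK' : Module.finrank ℚ K = 2 * 3 ^ 2 := by rw [hK]; norm_num
  by_cases hcyc : IsCyclic (K ≃ₐ[ℚ] K)
  · have := CyclicPrimeSquare.cmTypeRank_mem_of_isCyclic hcyc Nat.prime_three (by norm_num) hK' Φ
    norm_num at this
    simp only [Finset.mem_insert, Finset.mem_singleton]
    exact this
  · obtain ⟨φ₀⟩ : Nonempty (K →+* ℂ) := inferInstance
    obtain ⟨ρ, hρ⟩ := exists_conj_gal (K := K)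
    obtain ⟨τ, κ, hτ, hκ, hτκ⟩ := exists_frame Nat.prime_three (by norm_num) hcyc hK' (hρ φ₀)
    exact cmTypeRank_mem_three (hρ φ₀) hτ hκ hτκ hK Φ

/-- **Simple abelian `9`-folds with CM by an abelian CM field of degree `18`: the Hodge conjecture for all powers
iff rank `10`; rank `8` gives a `(3,3)`-class on `A` outside `D³(A) ⊗ ℂ`.** [cite: Dodson1987, Prop. 4.4 and Remark 4.7]
[cite: Gordon1999HodgeAVSurvey, Thm. 6.4 and 9.2.2] -/
theorem hodgeConjectureFor_pow_or_exceptional_of_isMulCommutative_eighteen [IsMulCommutative (K ≃ₐ[ℚ] K)]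
    (hK : Module.finrank ℚ K = 18) (Φ : CMType K) (hA : IsCMTypeRealisation Φ A ι θ) :
    (∀ n : ℕ, HodgeConjectureFor (⨁ fun _ : Fin n => A).dim (⨁ fun _ : Fin n => A).X) ∨
    (A.IsSimple ∧ A.dim = 9 ∧ cmTypeRank Φ = 8 ∧
      ∃ c : complexBetti A.X 6, IsRationalClass c ∧ IsOfHodgeType 9 A.X 6 3 3 c ∧
        c ∉ divisorClassesSpan A.X 9 3) := by
  have hK' : Module.finrank ℚ K = 2 * 3 ^ 2 := by rw [hK]; norm_num
  rcases hodgeConjectureFor_pow_or_exceptional_of_isMulCommutative Nat.prime_three (by norm_num) hK' Φ hA with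
    h | ⟨hS, hd, hnd, hc⟩
  · exact Or.inl h
  · right
    obtain ⟨φ₀⟩ : Nonempty (K →+* ℂ) := inferInstance
    have hprim := (isSimple_iff_isPrimitive hA φ₀).1 hS
    obtain ⟨h108, hiff⟩ := cmTypeRank_eq_or_of_isPrimitive_of_isMulCommutative_eighteen hK Φ hprim
    have h8 : cmTypeRank Φ = 8 := h108.resolve_left fun h10 => hnd (hiff.2 h10)
    refine ⟨hS, by norm_num at hd; exact hd, h8, ?_⟩
    norm_num at hc
    exact hc

end CoordinateFree

end ElemPrimeSquare

end Literature.AlgebraicGeometry.Pohlmann1968
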